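import Literature.LinearAlgebra.QuadraticForm.MaslovIndexTransverse
import Mathlib.LinearAlgebra.QuadraticForm.Signature
import Mathlib.LinearAlgebra.QuadraticForm.IsometryEquiv
import Mathlib.LinearAlgebra.QuadraticForm.Prod
import Mathlib.LinearAlgebra.Projection
import Mathlib.LinearAlgebra.Pi
import Mathlib.Tactic.LinearCombination
import HarnessLib

/-!
# Additivity of the signature over orthogonal direct sums (atom A7 of the `G`-signature
# bookkeeping; cell `hodge-kum4`, seat p2)

HONEST FRAMING.  Pure linear algebra over a linearly ordered field, PROVED with Mathlib's
`QuadraticForm.sigPos` / `sigNeg` (maximal dimension of a positive / negative definite subspace)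
and Sylvester's law (`QuadraticForm.equivalent_weightedSumSquares`,
`sigPos_of_equiv_weightedSumSquares`); no named fact; nothing about the Hodge conjecture.

* (`σ±(Q₁ ⊕ Q₂) = σ±(Q₁) + σ±(Q₂)` is the tree's `Literature.LinearAlgebra.QuadraticForm.sigPos_prod` / `sigNeg_prod`.)
* `sigPos_eq_add_of_isCompl_isOrtho`, `sigNeg_eq_add_of_isCompl_isOrtho`: the same for an INTERNAL
  decomposition `M = U ⊕ K` into `Q`-orthogonal complementary subspaces.
* `sigPos_eq_finrank_of_posDef`, `sigNeg_eq_zero_of_posDef`: a positive definite form has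
  signature `(dim, 0)`.

Use (G2-AUDIT §A5′): `H⁸ = (H⁸)^Γ ⊕ 𝒦` orthogonally, `𝒦 = 𝒦₊ ⊕ 𝒦₋`; so
`Sign(ι, X) = σ((H⁸)^Γ) + dim 𝒦₊ − dim 𝒦₋` and `σ(X) = σ((H⁸)^Γ) + dim 𝒦`.
-/

namespace Summit.Ventures.HodgeKum4.Signature

open QuadraticMap QuadraticForm Finset
open Literature.LinearAlgebra.QuadraticForm (sigPos_prod sigNeg_prod)

variable {𝕜 : Type*} [Field 𝕜] [LinearOrder 𝕜] [IsStrictOrderedRing 𝕜]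

/-! ### `σ±` of a product: the tree's `Literature.LinearAlgebra.QuadraticForm.sigPos_prod` /
`sigNeg_prod` (`MaslovIndexTransverse`) are used below (`σ±(Q₁ ⊕ Q₂) = σ±(Q₁) + σ±(Q₂)`). -/

/-! ### `σ±` of an internal orthogonal decomposition -/

section Internal

variable {M : Type*} [AddCommGroup M] [Module 𝕜 M] [FiniteDimensional 𝕜 M]

omit [LinearOrder 𝕜] [IsStrictOrderedRing 𝕜] [FiniteDimensional 𝕜 M] in
/-- For `Q`-orthogonal complementary subspaces `U, K` (`M = U ⊕ K`, `Q(u + k) = Q u + Q k`),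
`Q|U ⊕ Q|K` is equivalent to `Q`. -/
theorem equivalent_prod_of_isCompl (Q : QuadraticForm 𝕜 M) (U K : Submodule 𝕜 M)
    (h : IsCompl U K) (hUK : ∀ u ∈ U, ∀ k ∈ K, Q.IsOrtho u k) :
    ((Q.restrict U).prod (Q.restrict K)).Equivalent Q :=
  ⟨{ toLinearEquiv := Submodule.prodEquivOfIsCompl U K h
     map_app' := fun x ↦ by
      change Q (Submodule.prodEquivOfIsCompl U K h x) = _
      rw [Submodule.coe_prodEquivOfIsCompl', QuadraticMap.prod_apply, QuadraticMap.restrict_apply,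
        QuadraticMap.restrict_apply]
      exact (hUK _ x.1.2 _ x.2.2) }⟩

/-- **`σ₊(Q) = σ₊(Q|U) + σ₊(Q|K)` for an orthogonal decomposition `M = U ⊕ K`.** -/
theorem sigPos_eq_add_of_isCompl_isOrtho (Q : QuadraticForm 𝕜 M) (U K : Submodule 𝕜 M)
    (h : IsCompl U K) (hUK : ∀ u ∈ U, ∀ k ∈ K, Q.IsOrtho u k) :
    sigPos Q = sigPos (Q.restrict U) + sigPos (Q.restrict K) := by
  rw [← sigPos_prod]
  exact (equivalent_prod_of_isCompl Q U K h hUK).sigPos_eq.symm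

/-- **`σ₋(Q) = σ₋(Q|U) + σ₋(Q|K)` for an orthogonal decomposition `M = U ⊕ K`.** -/
theorem sigNeg_eq_add_of_isCompl_isOrtho (Q : QuadraticForm 𝕜 M) (U K : Submodule 𝕜 M)
    (h : IsCompl U K) (hUK : ∀ u ∈ U, ∀ k ∈ K, Q.IsOrtho u k) :
    sigNeg Q = sigNeg (Q.restrict U) + sigNeg (Q.restrict K) := by
  rw [← sigNeg_prod]
  exact (equivalent_prod_of_isCompl Q U K h hUK).sigNeg_eq.symm

/-! ### Definite forms -/

omit [IsStrictOrderedRing 𝕜] in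
/-- A positive definite form has `σ₊ = dim`. -/
theorem sigPos_eq_finrank_of_posDef {Q : QuadraticForm 𝕜 M} (hQ : Q.PosDef) :
    sigPos Q = Module.finrank 𝕜 M := by
  refine le_antisymm (sigPos_le_finrank Q) ?_
  have h := le_sigPos_of_posDef Q (V := ⊤) (fun x hx => hQ x.1 (by
    intro h0; apply hx; exact Subtype.ext h0))
  rwa [finrank_top] at h

/-- A positive definite form has `σ₋ = 0`. -/
theorem sigNeg_eq_zero_of_posDef {Q : QuadraticForm 𝕜 M} (hQ : Q.PosDef) : sigNeg Q = 0 := by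
  obtain ⟨V, hV, hneg⟩ := exists_finrank_eq_sigNeg_and_negDef Q
  rw [← hV]
  have hbot : V = ⊥ := by
    rw [Submodule.eq_bot_iff]
    intro x hx
    by_contra hx0
    have h1 := hneg ⟨x, hx⟩ (fun h0 => hx0 (by simpa using congrArg Subtype.val h0))
    have h2 := hQ x hx0
    rw [QuadraticMap.restrict_apply, QuadraticMap.neg_apply] at h1
    have h3 := add_pos h1 h2
    rw [neg_add_cancel] at h3
    exact lt_irrefl _ h3
  rw [hbot, finrank_bot]

/-! ### Twisting by an involution: `σ(B(·, ι·)) = σ(B|V₊) − σ(B|V₋)` (Hirzebruch's `Sign(ι)`) -/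

omit [FiniteDimensional 𝕜 M] in
/-- The `±1`-eigenspaces of an involution are complementary (field with `2 ≠ 0`). -/
theorem isCompl_ker_sub_id_ker_add_id (ι : M →ₗ[𝕜] M) (hι : ι ∘ₗ ι = LinearMap.id) :
    IsCompl (LinearMap.ker (ι - LinearMap.id)) (LinearMap.ker (ι + LinearMap.id)) := by
  have hιι : ∀ x, ι (ι x) = x := fun x => LinearMap.congr_fun hι x
  refine isCompl_iff.2 ⟨Submodule.disjoint_def.2 fun x hp hm => ?_,
    codisjoint_iff.2 (eq_top_iff.2 fun x _ => ?_)⟩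
  · rw [LinearMap.mem_ker, LinearMap.sub_apply, sub_eq_zero, LinearMap.id_apply] at hp
    rw [LinearMap.mem_ker, LinearMap.add_apply, LinearMap.id_apply, hp, ← two_smul 𝕜 x,
      smul_eq_zero] at hm
    exact hm.resolve_left two_ne_zero
  · have hx : x = (2 : 𝕜)⁻¹ • (x + ι x) + (2 : 𝕜)⁻¹ • (x - ι x) := by
      rw [← smul_add, add_add_sub_cancel, ← two_smul 𝕜 x, smul_smul, inv_mul_cancel₀ two_ne_zero,
        one_smul]
    rw [hx]
    refine Submodule.add_mem_sup (Submodule.smul_mem _ _ ?_) (Submodule.smul_mem _ _ ?_)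
    · rw [LinearMap.mem_ker, LinearMap.sub_apply, LinearMap.id_apply, map_add, hιι, sub_eq_zero,
        add_comm]
    · rw [LinearMap.mem_ker, LinearMap.add_apply, LinearMap.id_apply, map_sub, hιι,
        sub_add_sub_cancel', sub_self]

/-- **Bridging clause (referee R2): for a symmetric `B` and an involution `ι`, the signature of the
twisted form `B_ι(x, y) = B(x, ι y)` is Hirzebruch's `Sign(ι) = σ(B|V₊) − σ(B|V₋)`**, `V± = ker(ι ∓ 1)`:
`V = V₊ ⊕ V₋` is `B_ι`-orthogonal (`B_ι(a + b, a + b) = B(a,a) − B(b,b)` by symmetry) with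
`B_ι|V₊ = B|V₊` and `B_ι|V₋ = −B|V₋`.  No isometry hypothesis on `ι` is needed for this identity
(when `ι` IS a `B`-isometry, also `σ(B) = σ(B|V₊) + σ(B|V₋)`). -/
theorem sig_twist_involution_eq (B : LinearMap.BilinForm 𝕜 M) (hB : ∀ x y, B x y = B y x)
    (ι : M →ₗ[𝕜] M) (hι : ι ∘ₗ ι = LinearMap.id) :
    ((sigPos (LinearMap.BilinMap.toQuadraticMap (B.compl₂ ι)) : ℤ) -
        sigNeg (LinearMap.BilinMap.toQuadraticMap (B.compl₂ ι))) =
      ((sigPos ((LinearMap.BilinMap.toQuadraticMap B).restrict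
            (LinearMap.ker (ι - LinearMap.id))) : ℤ) -
          sigNeg ((LinearMap.BilinMap.toQuadraticMap B).restrict
            (LinearMap.ker (ι - LinearMap.id)))) -
        ((sigPos ((LinearMap.BilinMap.toQuadraticMap B).restrict
            (LinearMap.ker (ι + LinearMap.id))) : ℤ) -
          sigNeg ((LinearMap.BilinMap.toQuadraticMap B).restrict
            (LinearMap.ker (ι + LinearMap.id)))) := by
  set Q : QuadraticForm 𝕜 M := LinearMap.BilinMap.toQuadraticMap B with hQdef
  set Qι : QuadraticForm 𝕜 M := LinearMap.BilinMap.toQuadraticMap (B.compl₂ ι) with hQιdef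
  set Vp := LinearMap.ker (ι - LinearMap.id) with hVp
  set Vm := LinearMap.ker (ι + LinearMap.id) with hVm
  have hQ : ∀ x, Q x = B x x := fun x => rfl
  have hQι : ∀ x, Qι x = B x (ι x) := fun x => rfl
  have hmemp : ∀ {x}, x ∈ Vp ↔ ι x = x := by
    intro x; rw [hVp, LinearMap.mem_ker, LinearMap.sub_apply, sub_eq_zero, LinearMap.id_apply]
  have hmemm : ∀ {x}, x ∈ Vm ↔ ι x = -x := by
    intro x; rw [hVm, LinearMap.mem_ker, LinearMap.add_apply, add_eq_zero_iff_eq_neg,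
      LinearMap.id_apply]
  have hc : IsCompl Vp Vm := isCompl_ker_sub_id_ker_add_id ι hι
  have horth : ∀ a ∈ Vp, ∀ b ∈ Vm, Qι.IsOrtho a b := by
    intro a ha b hb
    simp only [QuadraticMap.isOrtho_def, hQι, map_add, LinearMap.add_apply, hmemp.1 ha, hmemm.1 hb,
      map_neg]
    linear_combination hB b a
  have hp : Qι.restrict Vp = Q.restrict Vp := by
    ext x
    rw [QuadraticMap.restrict_apply, QuadraticMap.restrict_apply, hQι, hQ, hmemp.1 x.2]
  have hm : Qι.restrict Vm = -(Q.restrict Vm) := by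
    ext x
    rw [QuadraticMap.neg_apply, QuadraticMap.restrict_apply, QuadraticMap.restrict_apply, hQι, hQ,
      hmemm.1 x.2, map_neg]
  have hnegneg : -(-(Q.restrict Vm)) = Q.restrict Vm := by
    ext x
    rw [QuadraticMap.neg_apply, QuadraticMap.neg_apply, neg_neg]
  rw [sigPos_eq_add_of_isCompl_isOrtho Qι Vp Vm hc horth,
    sigNeg_eq_add_of_isCompl_isOrtho Qι Vp Vm hc horth, hp, hm]
  unfold sigNeg
  rw [hnegneg]
  push_cast
  ring

/-! ### Sign change of the form -/

omit [IsStrictOrderedRing 𝕜] [FiniteDimensional 𝕜 M] in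
/-- `σ₊(−Q) = σ₋(Q)` (definition of `sigNeg`). -/
theorem sigPos_neg (Q : QuadraticForm 𝕜 M) : sigPos (-Q) = sigNeg Q := rfl

omit [IsStrictOrderedRing 𝕜] [FiniteDimensional 𝕜 M] in
/-- `σ₋(−Q) = σ₊(Q)`. -/
theorem sigNeg_neg (Q : QuadraticForm 𝕜 M) : sigNeg (-Q) = sigPos Q := by
  have h : -(-Q) = Q := by
    ext x
    rw [QuadraticMap.neg_apply, QuadraticMap.neg_apply, neg_neg]
  unfold sigNeg
  rw [h]

omit [LinearOrder 𝕜] [IsStrictOrderedRing 𝕜] [FiniteDimensional 𝕜 M] in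
/-- The quadratic form of `−B` is minus that of `B`. -/
theorem toQuadraticMap_neg (B : LinearMap.BilinForm 𝕜 M) :
    LinearMap.BilinMap.toQuadraticMap (-B) = -LinearMap.BilinMap.toQuadraticMap B := by
  ext x
  rfl

omit [LinearOrder 𝕜] [IsStrictOrderedRing 𝕜] [FiniteDimensional 𝕜 M] in
/-- Twisting commutes with negation: `(−B)(·, f ·) = −B(·, f ·)`. -/
theorem neg_compl₂ (B : LinearMap.BilinForm 𝕜 M) (f : M →ₗ[𝕜] M) :
    (-B).compl₂ f = -(B.compl₂ f) := by
  ext x y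
  rfl

omit [IsStrictOrderedRing 𝕜] [FiniteDimensional 𝕜 M] in
/-- **`σ(−B) = −σ(B)`** for the signature `σ = σ₊ − σ₋` of (the quadratic form of) a bilinear form. -/
theorem sig_neg_bilin (B : LinearMap.BilinForm 𝕜 M) :
    ((sigPos (LinearMap.BilinMap.toQuadraticMap (-B)) : ℤ) -
        sigNeg (LinearMap.BilinMap.toQuadraticMap (-B))) =
      -((sigPos (LinearMap.BilinMap.toQuadraticMap B) : ℤ) -
        sigNeg (LinearMap.BilinMap.toQuadraticMap B)) := by
  rw [toQuadraticMap_neg, sigPos_neg, sigNeg_neg]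
  ring

end Internal

end Summit.Ventures.HodgeKum4.Signature
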